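import Literature.NumberTheory.Automorphic.CuspidalContragredientProofs
import HarnessLib

/-!
# `ContragredientDatum` (item stmt-Langlands-14322 of route `IrreducibilityBySelfDuality`) — PROOF

Every cuspidal Borel–Jacquet datum `π` on `GL_n(𝔸_K)` (`K` a number field, any `n`) has a cuspidal
contragredient datum `π'` at the same level with inverse Satake parameters: wherever `π` has Satake
parameter `α`, `π'` has Satake parameter `α⁻¹` (at EVERY such place, not only almost everywhere).

## Proof
The item is, binder for binder, the ∀-closure over `n K hcpt` of the Literature named fact
`CuspidalAutomorphicRepData.exists_contragredient_satake hcpt`, and that fact is discharged in tree by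
`CuspidalAutomorphicRepData.exists_contragredient_satake_holds`
(`Literature.NumberTheory.Automorphic.CuspidalContragredientProofs`): the datum is
`π' = (W ∘ τ)/(W' ∘ τ)` for the involution `τ g = w₀ ᵗg⁻¹ w₀` of `GL_n(𝔸_K)`, which preserves the
level `K(𝔫)`, cuspidality and irreducibility and sends the Hecke operator `t_{v,i}` to
`t_{v,n}⁻¹ t_{v,n-i}`, so that `e_i(α⁻¹) = e_{n-i}(α)/e_n(α)` matches the Satake bookkeeping.

The closing theorem `ContragredientDatum_proof` is stated STRUCTURALLY (the route decl's text
verbatim) so that this module does not import the Theses file (the gate links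
`ContragredientDatum_holds` by importing this module into it); it is definitionally the route decl.

References: A. Borel, H. Jacquet, *Automorphic forms and automorphic representations* (Corvallis
1979), 4.6; J. Cogdell, *Lectures on L-functions, converse theorems, and functoriality for GL_n*
(2004), §2 Thm. 2.1; J. Getz, H. Hahn, *An introduction to automorphic representations* (2024),
Prop. 7.6.2.
-/

noncomputable section

set_option linter.dupNamespace false -- project-wide option (lakefile weak.linter.dupNamespace); `Summit.Langlands.Langlands` is the mandated namespace

namespace Summit.Langlands.Langlands.Theorems.ContragredientDatum

/-- **`ContragredientDatum`** (item stmt-Langlands-14322 of route `IrreducibilityBySelfDuality`),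
text verbatim: every cuspidal Borel–Jacquet datum on `GL_n(𝔸_K)` has a cuspidal contragredient datum
(at the same level) with inverse Satake parameters at every place where it has Satake parameters.
Proof: the discharged Literature fact `CuspidalAutomorphicRepData.exists_contragredient_satake_holds`
(`π' = (W ∘ τ)/(W' ∘ τ)`, `τ g = w₀ ᵗg⁻¹ w₀`). [cite: BorelJacquetCorvallis1979, 4.6]
[cite: CogdellAnalyticTheory2004, §2 Thm. 2.1] -/
theorem ContragredientDatum_proof :
    ∀ (n : ℕ) (K : Type) [Field K] [NumberField K] (hcpt : Literature.NumberTheory.Automorphic.isCompact_glFiniteIntegralLevel n K) (π : Literature.NumberTheory.Automorphic.CuspidalAutomorphicRepData n K hcpt), ∃ π' : Literature.NumberTheory.Automorphic.CuspidalAutomorphicRepData n K hcpt, ∀ (v : IsDedekindDomain.HeightOneSpectrum (NumberField.RingOfIntegers K)) (α : Multiset ℂ), π.1.HasSatakeParamAt v α → π'.1.HasSatakeParamAt v (α.map (·⁻¹)) :=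
  fun _ _ _ _ hcpt => Literature.NumberTheory.Automorphic.CuspidalAutomorphicRepData.exists_contragredient_satake_holds hcpt

end Summit.Langlands.Langlands.Theorems.ContragredientDatum
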